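import Literature.MathematicalPhysics.QuantumFieldTheory.Balaban1983to89.Node00.BgRemainderOfRecord
import Literature.MathematicalPhysics.QuantumFieldTheory.Balaban1983to89.Node00.LinearisedAveragingAtBackground
import HarnessLib

/-!
# (ℓa-C) ROAD B, FILE F1 — THE LINEARISATION OF THE LOG-AVERAGED CHART IS PRINT's `Q_k(U₀)` ([B9] (3.13) ∕ [B11] (44)), GENERIC over the [I] (0.4) averaging:
# `D(Ū^k_h)(↑U₀)[Y·U₀](c) · Ū^k(U₀)(c)⋆ = L^k · (Q_k(U₀)Y)(c)` for traceless `Y`, and the line derivative of `t ↦ (1/i)·log(Ū^k_h(e^{itY}U₀)(c)·Ū^k(U₀)(c)⋆)`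

Cell `pub-ymgap` ∕ `ym-nodeO-ideate`, porter lineage `ymgap-nodeO-port-PTB-1` (gen 6), hand «(44) for `iterMh`, GENERIC + Ω-PROFILE» keyed by director-ym g22 №569
(2026-08-31T11:36:48Z) on the (ℓa-C) letter `Prop4LetterCAtRecord` of node00-def-Y's ✓`Node00/BgSchemeOfRecordProp4.lean`; SPEC = HOME
`ymgap-nodeO-port-PTB-1/HAND-SPEC-C44-iterMh.md` 877df2046bcf01aa, FILE F1 = (B2d) «`qCplxOp k U₀` IS the ℂ-derivative at `0` of the log-averaged chart».  GENERIC over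
`Setup.Params P`, `N`, a background `U₀ : GaugeField P 0 (SU N)` under the (0.4) guard `SmallBelow (blockAvg expMeanLogSU) k U₀` — the record `(F.P K, avOfRecord F N K)` is the
instance `rfl` (✓`Node00.LinearisedAveragingAtBackground` §5).  `--kind proof --supports stmt-QuantumFields-27238 --as helper`; count-neutral.  [B7] = [Balaban1985Averaging];
[B9] = [Balaban1985BackgroundPropagators]; [B11] = [Balaban1985Variational]; [I] = [Balaban1987RG1].

THE POINT (3e′ ✓`Node00/BgConstraintOfRecord` HONEST (1): «NOT asserted … the identification `fderiv ℂ C 0 = 0` (equivalently: the derivative at `0` of the first summand of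
`C` is `qCplxOp k U₀ ∘ evLit`, [B9] (3.13))»).  The record's constraint letter `C(A′) = (1/i)·log(Ū^k_h(e^{iη A′}U₀)·Ū^k(U₀)⋆) − Q_k(U₀)A′` is a SECOND-ORDER remainder only if
the linear operator subtracted IS the derivative of the first summand.  def-Y's `qCplxOp k U₀ = cplxOp (qSkewOp k U₀)` reads the REAL derivative `dIterL k ↑U₀ = fderiv ℝ (iterM k)
↑U₀` of the TRUE `SU(N)` averaging (left chart, right-trivialised, `L^{-k}`-normalised), complexified from the real form; the first summand is the HOLOMORPHIC extension
`iterMh k` ([B15AveragingHolomorphic]: adjugate inverses).  The two agree along `SU(N)`-valued curves only (adjugate ≠ star off `det = 1`: 3e′∕3f′'s scalar-direction caveat,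
whence the traceless slice `CslOfRecord = COfRecord ∘ slProjLit`), so the identification holds exactly on TRACELESS directions — which is what this file proves.

WHAT IS PROVED (0 def, 0 sorry, axioms standard; ns `Summit.QuantumFields.YangMills.Theorems.C44IterMh`).
* §1 `hasFDerivAt_mlog_one` (`D log(1) = id` on `M_N(ℂ)`, the `N × N` edition of ✓`PortU8Linearisation.hasFDerivAt_mlog_one`), `hasDerivAt_exp_smul_mul_right` (`t ↦ e^{tA}u` has
  velocity `Au`), `star_mul_mul_mem_lieSU` (`Ad(u⋆)` preserves `𝔰𝔲(N)`).
* §2 ★★ `fderiv_iterMh_apply_eq_dIterL` — THE KEY LEMMA: under the guard below `k`, for every `𝔰𝔲(N)`-valued `Z`,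
  `fderiv ℂ (iterMh k) ↑U₀ [b ↦ Z_b·U₀,b] = dIterL k ↑U₀ [b ↦ Z_b·U₀,b]` — both are the velocity at `0` of `t ↦ ↑Ū^k(expChart U₀ (t • Ad(U₀⁻¹)Z))`
  (✓`hasDerivAt_coeField_iter_expChart_smul`; the holomorphic iterate composed with the chart by the chain rule through ✓`differentiableAt_iterMh`; the two curves agree
  near `0` by ✓`coeField_iter_eq_iterMh` + ✓`eventually_smallBelow_expChart`; `HasDerivAt.unique`).
* §3 `hasDerivAt_expOver_line` (velocity `(iY_b)U₀,b` of `t ↦ expOver U₀ (tY)`); ★★ `hasDerivAt_logChart_iterMh_line` — under the guard, for EVERY `Y` and coarse bond `c`,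
  `d∕dt|₀ (1/i)·log(Ū^k_h(e^{itY}U₀)(c)·Ū^k(U₀)(c)⋆) = D(Ū^k_h)(↑U₀)[Y·U₀](c)·Ū^k(U₀)(c)⋆` (chain rule: `D exp(0)`, the ℂ-derivative of `iterMh k`, `D log(1) = id`; the chart's
  `i` and the log-coordinate's `1/i` cancel by ℂ-linearity); `skewField_mem_lieSU` ∕ `skewField_negI_mem_lieSU` (the two skew parts of a traceless field are `𝔰𝔲`-valued);
  ★★★ `fderiv_iterMh_mul_star_eq_qCplxOp` — for `Y` with `tr Y_b = 0`: `D(Ū^k_h)(↑U₀)[Y·U₀](c) · Ū^k(U₀)(c)⋆ = L^k • (qCplxOp k U₀ Y)(c)` (§2 on `𝔞Y` and `𝔞(−iY)`,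
  ✓`skewField_decomp`, ✓`cplxOp_apply`, ✓`qSkewOp_apply`, ✓`coeField_iter_eq_iterM`).  The factor `L^k` is (44)'s «`exp[i L^kη Q_k(U₀)A + …]`»; at the record `L^kη_k = 1`.
* §4 (APPENDED) AT THE RECORD: `L_pow_mul_eta_cast` (`L^kη_k = 1`), ★`hasDerivAt_CslOfRecord_line_zero` (every line derivative of `C^{𝔰𝔩}` at `0` vanishes: §3 at
  `Y = ev(P A′)`, traceless by ✓`trace_equiv_slProjLit`), ★★★`hasFDerivAt_CslOfRecord_zero : HasFDerivAt (CslOfRecord F N K k Ω U₀ levB) 0 0` under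
  `SmallBelow (avOfRecord F N K) k U₀` (✓`analyticAt_CslOfRecord_zero` for differentiability, ✓`NegSup.continuousLinearEquiv` to read components, `HasDerivAt.unique`) and
  `fderiv_CslOfRecord_zero` — 3e′ `Node00/BgConstraintOfRecord` HONEST (1)'s missing «`fderiv ℂ C 0 = 0`» DISCHARGED on the traceless slice: the (44) letter of record IS a
  second-order remainder.  NEXT (same hand): §5 (B2a) locality of `iterMh k`; then F2 of the SPEC.

HONEST FRAMING.  Calculus identities over DEFINED objects under the (0.4) guard; nothing of [B7] Prop. 3 ∕ (133)–(135), [B9] (3.13)'s estimates or [B11] (44)'s bound is proved here —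
this is the LINEAR identification the (44) remainder bound (F2–F5 of the SPEC) starts from.  (ℓa-C)(ℓa-H)(ℓd) DISPLAYED; (R1)∕(R2) OPEN; K0ᴬ ⟨stmt-QuantumFields-27238⟩ NOT closed;
K0ᴬ∕K1ᴬ∕K3ᴬ 0∕3; NODE O 0∕1; COUNT 8∕28 · K 1∕4 UNMOVED; finite `𝕋⁴_{L^K}` at fixed ε — NOT continuum ∕ ℝ⁴ ∕ OS; **the Yang–Mills mass gap (Clay) is NOT proved by any of
this.**  No `sorry`, `instance`, `notation`, `set_option`; standard axioms.
-/

noncomputable section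

open scoped Matrix Matrix.Norms.L2Operator InnerProductSpace ComplexConjugate Topology
open NormedSpace (exp)
open Filter

namespace Summit.QuantumFields.YangMills.Theorems.C44IterMh

open Literature.MathematicalPhysics.QuantumFieldTheory.Balaban1983to89
open Literature.MathematicalPhysics.QuantumFieldTheory.Balaban1983to89.Node00
open BlockAveraging
open B15AveragingHolomorphic (iterMh iterMh_coeField_eq_iterM coeField_iter_eq_iterMh differentiableAt_iterMh)
open MatrixLog (mlog mlog_one analyticAt_mlog exp_mlog)
open T4AdjointCovarianceUnitary (lieSU expSU coe_expSU mem_lieSU_iff)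
open ExpMeanLog (expMeanLogSU)
open T4Continuum

variable {P : Params} {N : ℕ} [NeZero N]

/-! ## §1  Calculus of the chart pieces: `D exp(i·)(0) = i·id`, `D log (1) = id`, `Ad(u⁻¹)` preserves `𝔰𝔲(N)` -/

omit [NeZero N] in
/-- **`D log (1) = id`** on `M_N(ℂ)` (the series logarithm is the inverse of `exp` near `1`, `D exp (0) = id`) — the `N × N` edition of ✓`PortU8Linearisation.hasFDerivAt_mlog_one`.
[cite: Balaban1985Averaging, (21) p.21] -/
theorem hasFDerivAt_mlog_one :
    HasFDerivAt (mlog : Matrix (Fin N) (Fin N) ℂ → Matrix (Fin N) (Fin N) ℂ) (ContinuousLinearMap.id ℂ (Matrix (Fin N) (Fin N) ℂ)) 1 := by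
  have hd : DifferentiableAt ℂ (mlog : Matrix (Fin N) (Fin N) ℂ → Matrix (Fin N) (Fin N) ℂ) 1 := (analyticAt_mlog (by simp)).differentiableAt
  set L := fderiv ℂ (mlog : Matrix (Fin N) (Fin N) ℂ → Matrix (Fin N) (Fin N) ℂ) 1 with hL
  have hm : HasFDerivAt (mlog : Matrix (Fin N) (Fin N) ℂ → Matrix (Fin N) (Fin N) ℂ) L 1 := hd.hasFDerivAt
  have he : HasFDerivAt (exp : Matrix (Fin N) (Fin N) ℂ → Matrix (Fin N) (Fin N) ℂ) (1 : Matrix (Fin N) (Fin N) ℂ →L[ℂ] Matrix (Fin N) (Fin N) ℂ)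
      (mlog (1 : Matrix (Fin N) (Fin N) ℂ)) := by
    rw [mlog_one]; exact hasFDerivAt_exp_zero
  have hcomp : HasFDerivAt (fun X : Matrix (Fin N) (Fin N) ℂ => exp (mlog X)) ((1 : Matrix (Fin N) (Fin N) ℂ →L[ℂ] Matrix (Fin N) (Fin N) ℂ).comp L) 1 :=
    he.comp 1 hm
  have hev : (fun X : Matrix (Fin N) (Fin N) ℂ => exp (mlog X)) =ᶠ[𝓝 1] id := by
    have hopen : IsOpen {X : Matrix (Fin N) (Fin N) ℂ | ‖X - 1‖ < 1} :=
      isOpen_lt (continuous_norm.comp (continuous_id.sub continuous_const)) continuous_const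
    filter_upwards [hopen.mem_nhds (by simp : (1 : Matrix (Fin N) (Fin N) ℂ) ∈ {X : Matrix (Fin N) (Fin N) ℂ | ‖X - 1‖ < 1})] with X hX
    exact exp_mlog hX
  have hid : HasFDerivAt (id : Matrix (Fin N) (Fin N) ℂ → Matrix (Fin N) (Fin N) ℂ) ((1 : Matrix (Fin N) (Fin N) ℂ →L[ℂ] Matrix (Fin N) (Fin N) ℂ).comp L) 1 :=
    hcomp.congr_of_eventuallyEq hev.symm
  have huniq : (1 : Matrix (Fin N) (Fin N) ℂ →L[ℂ] Matrix (Fin N) (Fin N) ℂ).comp L = ContinuousLinearMap.id ℂ (Matrix (Fin N) (Fin N) ℂ) :=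
    hid.unique (hasFDerivAt_id 1)
  rw [ContinuousLinearMap.one_def, ContinuousLinearMap.id_comp] at huniq
  rwa [huniq] at hm

omit [NeZero N] in
/-- Along the line `t ↦ exp(t·A)·u` the velocity at `0` is `A·u`. [cite: Balaban1985Variational, (15) p.280, (18) p.281 (bookkeeping)] -/
theorem hasDerivAt_exp_smul_mul_right (A u : Matrix (Fin N) (Fin N) ℂ) :
    HasDerivAt (fun t : ℂ => exp (t • A) * u) (A * u) 0 := by
  have h := (hasDerivAt_exp_smul_const' (𝕂 := ℂ) A (0 : ℂ)).mul_const u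
  simpa using h

omit [NeZero N] in
/-- `Ad(u⋆)` preserves `𝔰𝔲(N)`: for `u ∈ SU(N)` and `Z ∈ 𝔰𝔲(N)`, `u⋆ Z u ∈ 𝔰𝔲(N)`. [cite: Balaban1985BackgroundPropagators, (3.1) p.390 (bookkeeping)] -/
theorem star_mul_mul_mem_lieSU (u : SU N) {Z : Matrix (Fin N) (Fin N) ℂ} (hZ : Z ∈ lieSU (Fin N)) :
    star (u : Matrix (Fin N) (Fin N) ℂ) * Z * (u : Matrix (Fin N) (Fin N) ℂ) ∈ lieSU (Fin N) := by
  rw [mem_lieSU_iff] at hZ ⊢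
  refine ⟨?_, ?_⟩
  · rw [star_mul, star_mul, star_star, hZ.1]
    noncomm_ring
  · rw [Matrix.trace_mul_cycle, Unitary.mul_star_self_of_mem (Matrix.specialUnitaryGroup_le_unitaryGroup u.2), one_mul, hZ.2]

/-! ## §2  The ℂ-derivative of the holomorphic iterate `iterMh k` at `↑U₀` agrees with `dIterL k ↑U₀` on `𝔰𝔲(N)`-tangent directions -/

/-- ★ **KEY LEMMA — `D(iterMh k)(↑U₀)[Z·U₀] = Q_k-velocity `dIterL k ↑U₀ [Z·U₀]` for every `𝔰𝔲(N)`-valued `Z`** (under the guard below `k`): both are the velocity at `0` of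
`t ↦ ↑Ū^k(exp(tZ)·U₀) = ↑Ū^k(expChart U₀ (t • Ad(U₀⁻¹)Z))` — the true `SU(N)` averaging along the chart (✓`hasDerivAt_coeField_iter_expChart_smul`) and its holomorphic extension
(✓`differentiableAt_iterMh`, equal to it near `0` by ✓`coeField_iter_eq_iterMh` + ✓`eventually_smallBelow_expChart`); `HasDerivAt.unique`.  The two derivatives differ OFF the
tangent space of `SU(N)^{bonds}` (adjugate ≠ star off `det = 1`) — whence the traceless hypothesis downstream. [cite: Balaban1985BackgroundPropagators, (3.13) p.393; Balaban1987RG1, (0.4) p.253, (0.21) p.256] -/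
theorem fderiv_iterMh_apply_eq_dIterL (U₀ : GaugeField P 0 (SU N)) {k : ℕ} (h : SmallBelow (fun j => blockAvg (P := P) (j := j) expMeanLogSU) k U₀)
    {Z : PBond P 0 → Matrix (Fin N) (Fin N) ℂ} (hZ : ∀ b, Z b ∈ lieSU (Fin N)) :
    fderiv ℂ (iterMh k : (PBond P 0 → Matrix (Fin N) (Fin N) ℂ) → PBond P k → Matrix (Fin N) (Fin N) ℂ) (coeField U₀)
        (fun b => Z b * (U₀ b : Matrix (Fin N) (Fin N) ℂ)) =
      dIterL k (coeField U₀) (fun b => Z b * (U₀ b : Matrix (Fin N) (Fin N) ℂ)) := by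
  set X' : PBond P 0 → lieSU (Fin N) :=
    fun b => ⟨star (U₀ b : Matrix (Fin N) (Fin N) ℂ) * Z b * (U₀ b : Matrix (Fin N) (Fin N) ℂ), star_mul_mul_mem_lieSU (U₀ b) (hZ b)⟩ with hX'
  have hX'b : ∀ b, (X' b : Matrix (Fin N) (Fin N) ℂ) = star (U₀ b : Matrix (Fin N) (Fin N) ℂ) * Z b * (U₀ b : Matrix (Fin N) (Fin N) ℂ) := fun b => rfl
  have hvel : (fun b => (U₀ b : Matrix (Fin N) (Fin N) ℂ) * (X' b : Matrix (Fin N) (Fin N) ℂ)) = fun b => Z b * (U₀ b : Matrix (Fin N) (Fin N) ℂ) := by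
    funext b
    have hu : (U₀ b : Matrix (Fin N) (Fin N) ℂ) * star (U₀ b : Matrix (Fin N) (Fin N) ℂ) = 1 :=
      Unitary.mul_star_self_of_mem (Matrix.specialUnitaryGroup_le_unitaryGroup (U₀ b).2)
    rw [hX'b b, ← mul_assoc, ← mul_assoc, hu, one_mul]
  -- the true averaging along the chart
  have h1 := hasDerivAt_coeField_iter_expChart_smul h X'
  -- the holomorphic iterate along the same chart (chain rule through the ℂ-derivative at `↑U₀`)
  have hγ : HasDerivAt (fun t : ℝ => coeField (expChart U₀ (t • X'))) (fun b => (U₀ b : Matrix (Fin N) (Fin N) ℂ) * (X' b : Matrix (Fin N) (Fin N) ℂ)) 0 :=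
    hasDerivAt_pi.2 fun b => hasDerivAt_coe_expChart_along (U := U₀) (c := fun t : ℝ => t • X') (hasDerivAt_ray X') (zero_smul ℝ X') b
  have hD : HasFDerivAt (iterMh k : (PBond P 0 → Matrix (Fin N) (Fin N) ℂ) → PBond P k → Matrix (Fin N) (Fin N) ℂ)
      (fderiv ℂ (iterMh k) (coeField U₀)) (coeField (expChart U₀ ((0 : ℝ) • X'))) := by
    rw [zero_smul, expChart_zero]
    exact (differentiableAt_iterMh k h).hasFDerivAt
  have h2 := (hD.restrictScalars ℝ).comp_hasDerivAt (0 : ℝ) hγ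
  -- the two curves agree near `t = 0` (the guard is open along the chart)
  have ht : Tendsto (fun t : ℝ => t • X') (𝓝 0) (𝓝 0) := by
    have hc : Continuous fun t : ℝ => t • X' := continuous_id.smul continuous_const
    simpa only [zero_smul] using hc.tendsto 0
  have hev : (fun t : ℝ => coeField (Averaging.iter (fun j => blockAvg (P := P) (j := j) expMeanLogSU) k (expChart U₀ (t • X'))))
      =ᶠ[𝓝 0] ((iterMh k : (PBond P 0 → Matrix (Fin N) (Fin N) ℂ) → PBond P k → Matrix (Fin N) (Fin N) ℂ) ∘
        fun t : ℝ => coeField (expChart U₀ (t • X'))) := by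
    filter_upwards [ht.eventually (eventually_smallBelow_expChart h)] with t hsb
    rw [Function.comp_apply]
    exact coeField_iter_eq_iterMh k hsb
  have h3 := h2.congr_of_eventuallyEq hev
  have huniq := h1.unique h3
  rw [hvel] at huniq
  rw [ContinuousLinearMap.coe_restrictScalars'] at huniq
  exact huniq.symm

/-! ## §3  The line derivative of the log-averaged chart `t ↦ (1/i)·log(Ū^k_h(e^{itY}U₀)(c)·Ū^k(U₀)(c)⋆)` and its identification with `L^k·Q_k(U₀)Y` on traceless `Y` -/

omit [NeZero N] in
/-- The chart curve `t ↦ e^{i t Y}·U₀` has bond-wise velocity `(iY_b)·U₀,b` at `t = 0`. [cite: Balaban1985Variational, (15) p.280, (18)–(19) p.281 (bookkeeping)] -/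
theorem hasDerivAt_expOver_line (U₀ : GaugeField P 0 (SU N)) (Y : PBond P 0 → Matrix (Fin N) (Fin N) ℂ) :
    HasDerivAt (fun t : ℂ => expOver U₀ (t • Y)) (fun b => (Complex.I • Y b) * (U₀ b : Matrix (Fin N) (Fin N) ℂ)) 0 := by
  refine hasDerivAt_pi.2 fun b => ?_
  have hfun : (fun t : ℂ => expOver U₀ (t • Y) b) = fun t : ℂ => exp (t • (Complex.I • Y b)) * (U₀ b : Matrix (Fin N) (Fin N) ℂ) := by
    funext t
    rw [expOver_apply, Pi.smul_apply, smul_comm]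
  rw [hfun]
  exact hasDerivAt_exp_smul_mul_right _ _

/-- ★ **THE LINE DERIVATIVE OF THE LOG-AVERAGED CHART**: under the guard below `k`, for every direction `Y` and coarse bond `c`,
`d∕dt|₀ (1/i)·log( Ū^k_h(e^{itY}·U₀)(c) · Ū^k(U₀)(c)⋆ ) = D(Ū^k_h)(↑U₀)[Y·U₀](c) · Ū^k(U₀)(c)⋆` (`Ū^k_h = iterMh k`; chain rule through `D exp(0)`, the ℂ-derivative of
`iterMh k` at `↑U₀` (✓`differentiableAt_iterMh`) and `D log(1) = id`; the `i` of the chart and the `1/i` of the log-coordinate cancel by ℂ-linearity).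
[cite: Balaban1985Variational, (20) p.281, (44) p.285; Balaban1987RG1, (0.4) p.253] -/
theorem hasDerivAt_logChart_iterMh_line (U₀ : GaugeField P 0 (SU N)) {k : ℕ} (h : SmallBelow (fun j => blockAvg (P := P) (j := j) expMeanLogSU) k U₀)
    (Y : PBond P 0 → Matrix (Fin N) (Fin N) ℂ) (c : PBond P k) :
    HasDerivAt (fun t : ℂ => logOver (coeField (Averaging.iter (fun j => blockAvg (P := P) (j := j) expMeanLogSU) k U₀)) (iterMh k (expOver U₀ (t • Y))) c)
      (fderiv ℂ (iterMh k : (PBond P 0 → Matrix (Fin N) (Fin N) ℂ) → PBond P k → Matrix (Fin N) (Fin N) ℂ) (coeField U₀)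
          (fun b => Y b * (U₀ b : Matrix (Fin N) (Fin N) ℂ)) c *
        star ((Averaging.iter (fun j => blockAvg (P := P) (j := j) expMeanLogSU) k U₀ c : SU N) : Matrix (Fin N) (Fin N) ℂ)) 0 := by
  set W : PBond P k → Matrix (Fin N) (Fin N) ℂ := coeField (Averaging.iter (fun j => blockAvg (P := P) (j := j) expMeanLogSU) k U₀) with hW
  set D := fderiv ℂ (iterMh k : (PBond P 0 → Matrix (Fin N) (Fin N) ℂ) → PBond P k → Matrix (Fin N) (Fin N) ℂ) (coeField U₀) with hDdef
  have hWc : W c = ((Averaging.iter (fun j => blockAvg (P := P) (j := j) expMeanLogSU) k U₀ c : SU N) : Matrix (Fin N) (Fin N) ℂ) := rfl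
  have hWu : W c * star (W c) = 1 := by
    rw [hWc]; exact Unitary.mul_star_self_of_mem (Matrix.specialUnitaryGroup_le_unitaryGroup (Averaging.iter _ k U₀ c).2)
  -- the inner curve `ψ t := Ū^k_h(e^{itY} U₀)` and its velocity
  have hD : HasFDerivAt (iterMh k : (PBond P 0 → Matrix (Fin N) (Fin N) ℂ) → PBond P k → Matrix (Fin N) (Fin N) ℂ) D (expOver U₀ ((0 : ℂ) • Y)) := by
    rw [zero_smul, expOver_zero]
    exact (differentiableAt_iterMh k h).hasFDerivAt
  have hψ := hD.comp_hasDerivAt (0 : ℂ) (hasDerivAt_expOver_line U₀ Y)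
  have hψc : HasDerivAt (fun t : ℂ => iterMh k (expOver U₀ (t • Y)) c * star (W c))
      (D (fun b => (Complex.I • Y b) * (U₀ b : Matrix (Fin N) (Fin N) ℂ)) c * star (W c)) 0 :=
    ((hasDerivAt_pi.1 hψ) c).mul_const (star (W c))
  -- the point of the logarithm is `1`
  have hψ0 : iterMh k (expOver U₀ ((0 : ℂ) • Y)) c * star (W c) = 1 := by
    rw [zero_smul, expOver_zero, ← coeField_iter_eq_iterMh k h, ← hW, hWu]
  have hlog : HasFDerivAt (mlog : Matrix (Fin N) (Fin N) ℂ → Matrix (Fin N) (Fin N) ℂ) (ContinuousLinearMap.id ℂ (Matrix (Fin N) (Fin N) ℂ))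
      (iterMh k (expOver U₀ ((0 : ℂ) • Y)) c * star (W c)) := by
    rw [hψ0]; exact hasFDerivAt_mlog_one
  have hcomp := (hlog.comp_hasDerivAt (0 : ℂ) hψc).const_smul (Complex.I⁻¹ : ℂ)
  -- clean the derivative: `I⁻¹ • (D[(I•Y)·U₀] c · W c⋆) = D[Y·U₀] c · W c⋆`
  have hlin : (fun b => (Complex.I • Y b) * (U₀ b : Matrix (Fin N) (Fin N) ℂ)) = Complex.I • fun b => Y b * (U₀ b : Matrix (Fin N) (Fin N) ℂ) := by
    funext b; rw [Pi.smul_apply, smul_mul_assoc]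
  have hderiv : (Complex.I⁻¹ : ℂ) • (ContinuousLinearMap.id ℂ (Matrix (Fin N) (Fin N) ℂ))
        (D (fun b => (Complex.I • Y b) * (U₀ b : Matrix (Fin N) (Fin N) ℂ)) c * star (W c))
      = D (fun b => Y b * (U₀ b : Matrix (Fin N) (Fin N) ℂ)) c * star (W c) := by
    rw [ContinuousLinearMap.id_apply, hlin, map_smul, Pi.smul_apply, smul_mul_assoc, smul_smul, inv_mul_cancel₀ Complex.I_ne_zero, one_smul]
  have hfin := hcomp.congr_deriv hderiv
  -- unfold `logOver`
  have hfun : (fun t : ℂ => logOver W (iterMh k (expOver U₀ (t • Y))) c)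
      = fun t : ℂ => (Complex.I⁻¹ : ℂ) • mlog (iterMh k (expOver U₀ (t • Y)) c * star (W c)) := by
    funext t; rw [logOver_apply]
  rw [hfun]
  exact hfin

omit [NeZero N] in
/-- The skew part of a traceless field is `𝔰𝔲(N)`-valued. [cite: Balaban1985BackgroundPropagators, p.393 (bookkeeping)] -/
theorem skewField_mem_lieSU {Y : PBond P 0 → Matrix (Fin N) (Fin N) ℂ} {b : PBond P 0} (hY : (Y b).trace = 0) :
    skewField Y b ∈ lieSU (Fin N) := by
  rw [mem_lieSU_iff, skewField_apply]
  refine ⟨?_, ?_⟩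
  · rw [Matrix.star_eq_conjTranspose, Matrix.conjTranspose_smul, Matrix.conjTranspose_sub, Matrix.conjTranspose_conjTranspose,
      show star (2⁻¹ : ℂ) = 2⁻¹ by simp, ← smul_neg, neg_sub]
  · rw [Matrix.trace_smul, Matrix.trace_sub, Matrix.trace_conjTranspose, hY, star_zero, sub_zero, smul_zero]

omit [NeZero N] in
/-- … and so is the skew part of `−iY`. [cite: Balaban1985BackgroundPropagators, p.393 (bookkeeping)] -/
theorem skewField_negI_mem_lieSU {Y : PBond P 0 → Matrix (Fin N) (Fin N) ℂ} {b : PBond P 0} (hY : (Y b).trace = 0) :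
    skewField (-Complex.I • Y) b ∈ lieSU (Fin N) :=
  skewField_mem_lieSU (Y := -Complex.I • Y) (by rw [Pi.smul_apply, Matrix.trace_smul, hY, smul_zero])

/-- ★★ **THE LINEARISATION OF THE LOG-AVERAGED CHART IS PRINT's `Q_k(U₀)` ON TRACELESS DIRECTIONS**: under the guard below `k`, for `Y` with `tr Y_b = 0`,
`D(Ū^k_h)(↑U₀)[Y·U₀](c) · Ū^k(U₀)(c)⋆ = L^k · (Q_k(U₀)Y)(c)` with `Q_k(U₀) = qCplxOp k U₀ = cplxOp (qSkewOp k U₀)` (✓`Node00.BgAveragingOfRecord`: the real derivative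
`dIterL k = fderiv ℝ (iterM k)` of the TRUE averaging, left chart, right-trivialised, `L^{-k}`-normalised, complexified) — §2 on the two `𝔰𝔲(N)`-valued parts
`𝔞Y`, `𝔞(−iY)` of `Y = 𝔞Y + i·𝔞(−iY)` (✓`skewField_decomp`) and ℂ-linearity of the holomorphic derivative.  The factor `L^k` is (44)'s «`exp[i L^kη Q_k(U₀)A + …]`»;
at the record `L^kη_k = 1`. [cite: Balaban1985BackgroundPropagators, (3.13)–(3.15) p.393; Balaban1985Variational, (44) p.285] -/
theorem fderiv_iterMh_mul_star_eq_qCplxOp (U₀ : GaugeField P 0 (SU N)) {k : ℕ} (h : SmallBelow (fun j => blockAvg (P := P) (j := j) expMeanLogSU) k U₀)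
    {Y : PBond P 0 → Matrix (Fin N) (Fin N) ℂ} (hY : ∀ b, (Y b).trace = 0) (c : PBond P k) :
    fderiv ℂ (iterMh k : (PBond P 0 → Matrix (Fin N) (Fin N) ℂ) → PBond P k → Matrix (Fin N) (Fin N) ℂ) (coeField U₀)
          (fun b => Y b * (U₀ b : Matrix (Fin N) (Fin N) ℂ)) c *
        star ((Averaging.iter (fun j => blockAvg (P := P) (j := j) expMeanLogSU) k U₀ c : SU N) : Matrix (Fin N) (Fin N) ℂ)
      = ((P.L : ℂ) ^ k) • qCplxOp k U₀ Y c := by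
  set D := fderiv ℂ (iterMh k : (PBond P 0 → Matrix (Fin N) (Fin N) ℂ) → PBond P k → Matrix (Fin N) (Fin N) ℂ) (coeField U₀) with hDdef
  have hL : ((P.L : ℂ) ^ k) ≠ 0 := pow_ne_zero _ (Nat.cast_ne_zero.2 P.L_pos.ne')
  -- the two `𝔰𝔲`-valued parts and §2 on each
  have h1 := fderiv_iterMh_apply_eq_dIterL U₀ h (Z := skewField Y) fun b => skewField_mem_lieSU (hY b)
  have h2 := fderiv_iterMh_apply_eq_dIterL U₀ h (Z := skewField (-Complex.I • Y)) fun b => skewField_negI_mem_lieSU (hY b)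
  -- unfold print's operator
  rw [qCplxOp, cplxOp_apply, Pi.add_apply, Pi.smul_apply, qSkewOp_apply, qSkewOp_apply, ← coeField_iter_eq_iterM k h, coeField_apply, ← h1, ← h2,
    ← hDdef]
  -- ℂ-linearity of `D` reassembles `Y = 𝔞Y + i·𝔞(−iY)`
  have hsum : (fun b => Y b * (U₀ b : Matrix (Fin N) (Fin N) ℂ))
      = (fun b => skewField Y b * (U₀ b : Matrix (Fin N) (Fin N) ℂ)) + Complex.I • fun b => skewField (-Complex.I • Y) b * (U₀ b : Matrix (Fin N) (Fin N) ℂ) := by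
    funext b
    rw [Pi.add_apply, Pi.smul_apply, ← smul_mul_assoc, ← add_mul]
    congr 1
    have hb := congrFun (skewField_decomp Y) b
    rw [Pi.add_apply, Pi.smul_apply] at hb
    exact hb.symm
  rw [hsum, map_add, map_smul, Pi.add_apply, Pi.smul_apply, add_mul, smul_mul_assoc, smul_add, smul_smul, mul_inv_cancel₀ hL, one_smul,
    smul_comm ((P.L : ℂ) ^ k) Complex.I, smul_smul ((P.L : ℂ) ^ k), mul_inv_cancel₀ hL, one_smul]

/-! ## §4  AT THE RECORD: `fderiv ℂ (CslOfRecord …) 0 = 0` — the constraint letter `C^{𝔰𝔩}` of (44) is a genuine second-order remainder (3e′ HONEST (1) discharged) -/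

section Record

open T4Continuum (T4Family)
open B11Eq115Space (NegSup NegSize levWeight JetSup)

variable (F : T4Family) {K : ℕ} (k : ℕ) (Ω : ℕ → Set (Site (F.P K) 0)) (U₀ : GaugeField (F.P K) 0 (SU N))

omit [NeZero N] in
/-- `L^k · η_k = 1` for the record's spacings `η_k = L^{-k}` — (44)'s factor `L^kη` is `1` at the record. [cite: Balaban1985Variational, (44) p.285; Balaban1987RG1, (1.2) p.260] -/
theorem L_pow_mul_eta_cast : ((F.P K).L : ℂ) ^ k * ((((F.P K).eta k : ℝ) : ℂ)) = 1 := by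
  have hL : ((F.P K).L : ℂ) ≠ 0 := Nat.cast_ne_zero.2 (F.P K).L_pos.ne'
  rw [Params.eta, Complex.ofReal_pow, Complex.ofReal_inv, Complex.ofReal_natCast, ← mul_pow, mul_inv_cancel₀ hL, one_pow]

variable [Fact (0 < (F.L : ℝ))] [Fact (0 < (F.P K).eta k)]

/-- ★ **THE LINE DERIVATIVES OF `C^{𝔰𝔩}` AT `0` VANISH**: under the guard below `k`, for every `A′` and level-`k` bond `c`,
`d∕dt|₀ C^{𝔰𝔩}(t·A′)(c) = η_k·L^k·(Q_k(U₀)Y)(c) − (Q_k(U₀)Y)(c) = 0` with `Y = ev(P A′)` traceless (✓`trace_equiv_slProjLit`) — §3 at `Y`, linearity of `ev ∘ P` and of `Q_k(U₀)`,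
`L^kη_k = 1`. [cite: Balaban1985Variational, (44) p.285, (51) p.286; Balaban1985BackgroundPropagators, (3.13) p.393] -/
theorem hasDerivAt_CslOfRecord_line_zero (levB : PBond (F.P K) k → ℕ) (hU₀ : SmallBelow (avOfRecord F N K) k U₀) (A : Space115Lit F N K k Ω U₀)
    (c : PBond (F.P K) k) :
    HasDerivAt (fun t : ℂ => NegSup.equiv _ _ (CslOfRecord F N K k Ω U₀ levB (t • A)) c) 0 0 := by
  set Y : PBond (F.P K) 0 → Matrix (Fin N) (Fin N) ℂ := evLit F N K k Ω U₀ (slProjLit F N K k Ω U₀ A) with hYdef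
  set η : ℂ := ((((F.P K).eta k : ℝ) : ℂ)) with hη
  have hYtr : ∀ b, (Y b).trace = 0 := fun b => by
    rw [hYdef, evLit_apply]; exact trace_equiv_slProjLit (F := F) (N := N) (K := K) (k := k) (Ω := Ω) (U₀ := U₀) A _
  -- unfold the line: `C^{sl}(tA)(c) = (1/i) log(Ū^k_h(e^{t·(ηY)}U₀)(c)·W̄(c)⋆) − t·(Q_k Y)(c)`
  have hfun : (fun t : ℂ => NegSup.equiv _ _ (CslOfRecord F N K k Ω U₀ levB (t • A)) c)
      = fun t : ℂ => logOver (coeField (Averaging.iter (fun j => blockAvg (P := F.P K) (j := j) expMeanLogSU) k U₀))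
            (iterMh k (expOver U₀ (t • (η • Y)))) c - t • qCplxOp k U₀ Y c := by
    funext t
    rw [CslOfRecord_apply, map_smul, COfRecord_apply, map_smul, map_smul, smul_comm η t, Pi.smul_apply, logOver_apply, coeField_apply]
    rfl
  rw [hfun]
  have h1 := hasDerivAt_logChart_iterMh_line U₀ hU₀ (η • Y) c
  have h2 : HasDerivAt (fun t : ℂ => t • qCplxOp k U₀ Y c) (qCplxOp k U₀ Y c) 0 := by
    have h := (hasDerivAt_id (0 : ℂ)).smul_const (qCplxOp k U₀ Y c)
    rw [one_smul] at h
    exact h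
  refine (h1.sub h2).congr_deriv ?_
  -- `D[(ηY)·U₀] c · W̄c⋆ − Q Y c = η·L^k·Q Y c − Q Y c = 0`
  have hlin : (fun b => (η • Y) b * (U₀ b : Matrix (Fin N) (Fin N) ℂ)) = η • fun b => Y b * (U₀ b : Matrix (Fin N) (Fin N) ℂ) := by
    funext b; rw [Pi.smul_apply, Pi.smul_apply, smul_mul_assoc]
  rw [hlin, map_smul, Pi.smul_apply, smul_mul_assoc, fderiv_iterMh_mul_star_eq_qCplxOp U₀ hU₀ hYtr c, smul_smul, mul_comm η,
    L_pow_mul_eta_cast F k, one_smul, sub_self]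

/-- ★★ **`D C^{𝔰𝔩}(0) = 0` AT THE RECORD** (3e′ `Node00/BgConstraintOfRecord` HONEST (1)'s missing identification): under the small-field guard of `U₀` below `k`,
`HasFDerivAt (CslOfRecord F N K k Ω U₀ levB) 0 0` — the constraint letter `C^{𝔰𝔩}(A′) = (1/i)·log(Ū^k_h(e^{iη_kA′}U₀)·Ū^k(U₀)⋆) − Q_k(U₀)A′` on print's `𝔤ᶜ`-valued fields
has NO linear term: it is the second-order remainder (44)∕(55) speak of («a power series expansion … begins with second order terms», p.286).  From the line derivatives
(`hasDerivAt_CslOfRecord_line_zero`), ℂ-differentiability at `0` (✓`analyticAt_CslOfRecord_zero`) and the weighted-sup identification ✓`NegSup.continuousLinearEquiv`.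
[cite: Balaban1985Variational, (44) p.285, (55) p.286, (51) p.286; Balaban1985BackgroundPropagators, (3.13) p.393] -/
theorem hasFDerivAt_CslOfRecord_zero (levB : PBond (F.P K) k → ℕ) (hU₀ : SmallBelow (avOfRecord F N K) k U₀) :
    HasFDerivAt (CslOfRecord F N K k Ω U₀ levB) (0 : Space115Lit F N K k Ω U₀ →L[ℂ] NegSize (F.L : ℝ) ((F.P K).eta k) levB 0 (Matrix (Fin N) (Fin N) ℂ)) 0 := by
  have hd : DifferentiableAt ℂ (CslOfRecord F N K k Ω U₀ levB) 0 :=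
    (analyticAt_CslOfRecord_zero (F := F) (N := N) (K := K) (k := k) (Ω := Ω) (U₀ := U₀) levB hU₀).differentiableAt
  have hF := hd.hasFDerivAt
  suffices h0 : fderiv ℂ (CslOfRecord F N K k Ω U₀ levB) 0 = 0 by rwa [h0] at hF
  ext A
  change fderiv ℂ (CslOfRecord F N K k Ω U₀ levB) 0 A = 0
  -- the line `t ↦ C^{sl}(tA)` read through the weighted-sup identification `E`
  set E := NegSup.continuousLinearEquiv ℂ (V := Matrix (Fin N) (Fin N) ℂ) (levWeight (F.L : ℝ) ((F.P K).eta k) levB 0) with hE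
  have hline : HasDerivAt (fun t : ℂ => t • A) A 0 := by
    have h := (hasDerivAt_id (0 : ℂ)).smul_const A
    rw [one_smul] at h
    exact h
  have hEF : HasFDerivAt (fun A' => E (CslOfRecord F N K k Ω U₀ levB A'))
      ((E : NegSize (F.L : ℝ) ((F.P K).eta k) levB 0 (Matrix (Fin N) (Fin N) ℂ) →L[ℂ] (PBond (F.P K) k → Matrix (Fin N) (Fin N) ℂ)).comp
        (fderiv ℂ (CslOfRecord F N K k Ω U₀ levB) 0)) 0 :=
    E.hasFDerivAt.comp 0 hF
  have hcurve := hEF.comp_hasDerivAt_of_eq (0 : ℂ) hline (zero_smul ℂ A).symm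
  have hzero : HasDerivAt ((fun A' => E (CslOfRecord F N K k Ω U₀ levB A')) ∘ fun t : ℂ => t • A) 0 0 := by
    refine hasDerivAt_pi.2 fun c => ?_
    have h := hasDerivAt_CslOfRecord_line_zero F k Ω U₀ levB hU₀ A c
    exact h.congr_of_eventuallyEq (Eventually.of_forall fun t => rfl)
  have huniq : ((E : NegSize (F.L : ℝ) ((F.P K).eta k) levB 0 (Matrix (Fin N) (Fin N) ℂ) →L[ℂ] (PBond (F.P K) k → Matrix (Fin N) (Fin N) ℂ)).comp
      (fderiv ℂ (CslOfRecord F N K k Ω U₀ levB) 0)) A = 0 := hcurve.unique hzero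
  rw [ContinuousLinearMap.comp_apply] at huniq
  exact E.injective (by rw [map_zero]; exact huniq)

/-- Equivalently: `fderiv ℂ (CslOfRecord …) 0 = 0`. [cite: Balaban1985Variational, (44) p.285, (55) p.286] -/
theorem fderiv_CslOfRecord_zero (levB : PBond (F.P K) k → ℕ) (hU₀ : SmallBelow (avOfRecord F N K) k U₀) :
    fderiv ℂ (CslOfRecord F N K k Ω U₀ levB) 0 = 0 :=
  (hasFDerivAt_CslOfRecord_zero F k Ω U₀ levB hU₀).fderiv

end Record

end Summit.QuantumFields.YangMills.Theorems.C44IterMh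

end
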